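import Mathlib
import Literature.Computability.QuantumComplexity.GaussianRank
import Summits.QuantumAdvantage.QuantumAdvantage.Theses.SpinorFlattening

/-!
# Crux GaussRankTwoCopies (stmt-QuantumAdvantage-1248) — ideator 3, round 1: first lemmas of three lines

All statements are over the landed API `Literature.Computability.QuantumComplexity.GaussianRank`
(`majorana`, `IsGaussian`, `magicMPow`) and Mathlib matrices; nothing here is proved except the
wiring `borderRankFour_imp_crux` and they are NOT claimed as theorems of the tree.

* card `clifford-monoid-pencil`   : `TopStratumFree`, `CutSimilitude`
* card `lagrangian-triple-rigidity`: `TransverseTripleFree`, `CommonAnnihilatorFree`, `bilinC_intertwines`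
* card `borel-fixed-limit-planes` : `ProductFactorsGaussian`, `BorderRankFour`, wiring to the crux
* gen-2 ADDENDUM (round 1, same seat): the COMPLETE line of card `lagrangian-triple-rigidity` —
  `quadOp`, `majv`, `StabiliserBlockDiagonal`, `MutuallyAnnihilatingBound` (Lemma C),
  `PairProductAnnihilates`, `NonTransversePairFree` (case D), `TransverseTripleFreeAnn` (case E) and
  the PROVED wiring `crux_of_cases : NonTransversePairFree → TransverseTripleFreeAnn → GaussRankTwoCopies`.
-/

namespace Summit.QuantumAdvantage.QuantumAdvantage.Cruxes.GaussRankTwoCopies.Ideator3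

open Literature.Computability.QuantumComplexity Literature.Computability.Cryptography Matrix
open scoped BigOperators

noncomputable section

/-- Reshape an 8-qubit amplitude vector across the 4|4 cut (block A = wires 0–3 = rows,
block B = wires 4–7 = columns): the Choi matrix of the state. -/
def cutMatrix (ψ : QReg 8 → ℂ) : Matrix (QReg 4) (QReg 4) ℂ :=
  Matrix.of fun x y => ψ (Fin.append x y)

/-- The charge-conjugation matrix `C = X ⊗ Y ⊗ X ⊗ Y ⊗ ⋯` (X on even wires, Y on odd wires,
0-based). Claim (card 3, checked numerically in kit j008398/A1): `C c_p C⁻¹ = c_pᵀ` for every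
Jordan–Wigner Majorana, `C² = 1`, `Cᵀ = C` for `n ≡ 0 (mod 4)`; hence `β(u,v) = uᵀ C v` is the
`Spin(2n)`-invariant symmetric bilinear form on spinors. -/
def bilinC (n : ℕ) : Matrix (QReg n) (QReg n) ℂ :=
  pauliString (fun i : Fin n => if i.val % 2 = 0 then Pauli.X else Pauli.Y)

/-- The invariant bilinear pairing of two 8-qubit vectors. `bilin g g' = 0` iff the annihilator
spaces of two Gaussian states intersect nontrivially (Cartan–Chevalley). -/
def bilin (u v : QReg 8 → ℂ) : ℂ := u ⬝ᵥ (bilinC 8 *ᵥ v)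

/-- Parity projectors on 4 qubits (diagonal 0/1 matrices). -/
def evenProj : Matrix (QReg 4) (QReg 4) ℂ :=
  Matrix.diagonal fun x => if (Finset.univ.filter fun i => x i = true).card % 2 = 0 then 1 else 0
def oddProj : Matrix (QReg 4) (QReg 4) ℂ :=
  Matrix.diagonal fun x => if (Finset.univ.filter fun i => x i = true).card % 2 = 1 then 1 else 0

/-- Even fermionic parity of an `n`-qubit vector: no amplitude on odd-weight strings. -/
def IsEven {n : ℕ} (ψ : QReg n → ℂ) : Prop :=
  ∀ x, (Finset.univ.filter fun i => x i = true).card % 2 = 1 → ψ x = 0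

/-! ## Card 1 — `clifford-monoid-pencil` -/

/-- DICTIONARY LEMMA (Choi / Clifford-monoid model). An even 8-mode Gaussian state, reshaped
across the cut, is a pair of SIMILITUDES for the block form `C₄ = XYXY` (`C₄² = 1`): on the even
and on the odd sector `E C₄ Eᵀ ∝ C₄` (multipliers `λ`, `μ`; expected `μ = -λ`). This is the
statement "even pure spinors of D₈ restricted to D₄ × D₄ = closed cone over the conformal spin
group CSpin(8,ℂ) ⊂ End S₊ ⊕ End S₋". -/
def CutSimilitude : Prop :=
  ∀ g : QReg 8 → ℂ, IsGaussian g → IsEven g →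
    ∃ lam mu : ℂ, cutMatrix g * bilinC 4 * (cutMatrix g)ᵀ = (lam • evenProj + mu • oddProj) * bilinC 4

/-- TOP STRATUM THEOREM (card 1's first lemma; proved on paper in the card): there is no
decomposition `M⊗M = a₁g₁ + a₂g₂ + a₃g₃` in which all three Gaussians have full cut-rank
(invertible Choi matrix, i.e. four BCS pairs across the cut / invertible Gaussian operator). -/
def TopStratumFree : Prop :=
  ∀ (a : Fin 3 → ℂ) (g : Fin 3 → QReg (2 * 4) → ℂ),
    (∀ i, IsGaussian (g i)) → (∀ i, IsUnit (cutMatrix (g i)).det) →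
      magicMPow 2 ≠ ∑ i, a i • g i

/-! ## Card 3 — `lagrangian-triple-rigidity` -/

/-- `C` intertwines every Majorana with its transpose (so `uᵀ C v` is Clifford-invariant). -/
def bilinC_intertwines : Prop :=
  ∀ p : Fin 8 × Bool, bilinC 8 * majorana 8 p.1 p.2 * bilinC 8 = (majorana 8 p.1 p.2)ᵀ

/-- TRANSVERSE TRIPLE THEOREM (card 3's first lemma; proved on paper in the card): no 3-term
Gaussian decomposition of `M⊗M` whose three annihilator Lagrangians are pairwise transverse
(`β(gᵢ,gⱼ) ≠ 0`), because the pointwise stabiliser `Sp(8,ℂ)` of such a triple cannot sit in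
`Stab(M⊗M)° = Spin(7) × Spin(7)`. -/
def TransverseTripleFree : Prop :=
  ∀ (a : Fin 3 → ℂ) (g : Fin 3 → QReg (2 * 4) → ℂ),
    (∀ i, IsGaussian (g i)) → (∀ i j, i ≠ j → bilin (g i) (g j) ≠ 0) →
      magicMPow 2 ≠ ∑ i, a i • g i

/-- SUPPORT: a common annihilator of all terms kills any decomposition, since `M⊗M` has
trivial annihilator space (`c(v) (M⊗M) = 0 ⇒ v = 0`). Equivalently `L₁ ∩ L₂ ∩ L₃ = 0` is forced. -/
def CommonAnnihilatorFree : Prop :=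
  ∀ (r : ℕ) (a : Fin r → ℂ) (g : Fin r → QReg (2 * 4) → ℂ) (v : Fin 8 × Bool → ℂ), v ≠ 0 →
    (∀ i, (∑ p, v p • majorana 8 p.1 p.2) *ᵥ g i = 0) → magicMPow 2 ≠ ∑ i, a i • g i

/-! ## Card 2 — `borel-fixed-limit-planes` -/

/-- PUNCHLINE LEMMA used at every candidate plane: a Gaussian PRODUCT state across the cut has
Gaussian factors (pure reduced states of a Gaussian state are Gaussian). -/
def ProductFactorsGaussian : Prop :=
  ∀ (u v : QReg 4 → ℂ),
    IsGaussian (fun z : QReg (4 + 4) => u (fun i => z (Fin.castAdd 4 i)) * v (fun j => z (Fin.natAdd 4 j))) →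
      IsGaussian u ∧ IsGaussian v

/-- TRANSFER TARGET C⁺ of card 2: BORDER Gaussian rank of `M⊗M` is ≥ 4 — no sequence of 3-term
Gaussian combinations converges to `M⊗M`. -/
def BorderRankFour : Prop :=
  ∀ (a : ℕ → Fin 3 → ℂ) (g : ℕ → Fin 3 → QReg (2 * 4) → ℂ), (∀ n i, IsGaussian (g n i)) →
    ¬ Filter.Tendsto (fun n => ∑ i, a n i • g n i) Filter.atTop (nhds (magicMPow 2))

/-- Wiring: the border statement implies the crux (constant sequences). -/
theorem borderRankFour_imp_crux :
    BorderRankFour → Summit.QuantumAdvantage.QuantumAdvantage.Theses.SpinorFlattening.GaussRankTwoCopies := by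
  intro h a g hg heq
  refine h (fun _ => a) (fun _ => g) (fun _ i => ?_) ?_
  · exact hg i
  · have : (fun _ : ℕ => ∑ i, a i • g i) = fun _ => magicMPow 2 := by
      funext n; exact heq.symm
    rw [this]
    exact tendsto_const_nhds

/-! ## gen-2 ADDENDUM — card `lagrangian-triple-rigidity`, the complete line

Paper proof (Ideator3Notes.md §6): if `M⊗M = Σ_{i<3} aᵢ gᵢ` then every quadratic Majorana
operator killing the three `gᵢ` kills `M⊗M`; the Lie stabiliser of `M⊗M` in `so(16)` is
`stab(m)_A ⊕ stab(m)_B` (block-diagonal, `StabiliserBlockDiagonal`); for a non-transverse pair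
`D = L₁ ∩ L₂ ≠ 0` the bivectors `d ∧ w` (`d ∈ D`, `w ∈ L₃ ∩ D^⊥`) kill all three terms
(`PairProductAnnihilates`), span `d(8-d) ≥ 12` dimensions and multiply to zero pairwise, while a
pairwise-annihilating family of skew `X` with `Q(X) m = 0` has at most 5 members per block
(`MutuallyAnnihilatingBound`, Lemma C) — contradiction (`NonTransversePairFree`, case D); for a
pairwise transverse triple `sp(8) ⊂ stab` would make the block `V_A` an `sp(8)`-submodule of
`E ⊕ E*` carrying a non-degenerate invariant SYMMETRIC form — impossible by Schur
(`TransverseTripleFreeAnn`, case E). `crux_of_cases` is the kernel-checked composition. -/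

/-- The quadratic Majorana operator `Q(X) = Σ_{p,q} X_{pq} c_p c_q` of a coefficient matrix `X`
(for skew `X` this is the spin action of `X ∈ so(2n, ℂ) ≅ Λ²ℂ^{2n}`, up to a harmless factor). -/
def quadOp (n : ℕ) (X : Matrix (Fin n × Bool) (Fin n × Bool) ℂ) : Matrix (QReg n) (QReg n) ℂ :=
  ∑ p : Fin n × Bool, ∑ q : Fin n × Bool, X p q • (majorana n p.1 p.2 * majorana n q.1 q.2)

/-- The Clifford element `c(v) = Σ_p v_p c_p` of a vector `v ∈ ℂ^{2n}`. -/
def majv (n : ℕ) (v : Fin n × Bool → ℂ) : Matrix (QReg n) (QReg n) ℂ :=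
  ∑ p : Fin n × Bool, v p • majorana n p.1 p.2

/-- Wire `j` of block A (wires 0–3) resp. block B (wires 4–7) as a wire of the 8-qubit register. -/
def inA (j : Fin 4) : Fin 8 := ⟨j.val, by have := j.isLt; omega⟩
def inB (j : Fin 4) : Fin 8 := ⟨j.val + 4, by have := j.isLt; omega⟩

/-- The `A`-block and the `B`-block of a `16 × 16` coefficient matrix (Majorana labels of block A =
wires 0–3, of block B = wires 4–7). -/
def blockA (X : Matrix (Fin 8 × Bool) (Fin 8 × Bool) ℂ) : Matrix (Fin 4 × Bool) (Fin 4 × Bool) ℂ :=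
  Matrix.of fun p q => X (inA p.1, p.2) (inA q.1, q.2)
def blockB (X : Matrix (Fin 8 × Bool) (Fin 8 × Bool) ℂ) : Matrix (Fin 4 × Bool) (Fin 4 × Bool) ℂ :=
  Matrix.of fun p q => X (inB p.1, p.2) (inB q.1, q.2)

/-- STABILISER LEMMA (step A of the line; hand-proved, Ideator3Notes §0/§6; dim = 21 + 21 = 42
confirmed exactly by the item's evidence isotropy_check.out): a skew `X ∈ so(16,ℂ)` whose
quadratic operator kills `M⊗M` has NO mixed `A/B` entries (the 64 vectors `(c_a m) ⊗ (c_b m)` are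
independent because `m` has no annihilator), and each diagonal block kills `m = |M⟩` itself
(`Q(X_A) m = μ m`, `Q(X_B) m = -μ m`, and `μ = 0` by `β`-skewness since `β(m,m) ≠ 0`). -/
def StabiliserBlockDiagonal : Prop :=
  ∀ X : Matrix (Fin 8 × Bool) (Fin 8 × Bool) ℂ, Xᵀ = -X → quadOp 8 X *ᵥ magicMPow 2 = 0 →
    (∀ p q : Fin 8 × Bool, p.1.val < 4 → 4 ≤ q.1.val → X p q = 0) ∧
      quadOp 4 (blockA X) *ᵥ magicM = 0 ∧ quadOp 4 (blockB X) *ᵥ magicM = 0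

/-- LEMMA C (the load-bearing bound; hand-proved, Ideator3Notes §6.3): skew `8 × 8` matrices
`X₁, …, X₆` on ONE block that multiply to zero pairwise (`Xᵢ Xⱼ = 0`, squares included) and whose
quadratic operators all kill `|M⟩` are linearly DEPENDENT. Proof: `I := Σ im Xᵢ` is isotropic
(`im Xⱼ ⊂ ker Xᵢ = (im Xᵢ)^⊥`), all `Xᵢ ∈ Λ²I`, `dim Λ²I ≤ 6` with equality iff `I` is Lagrangian,
and `Λ²I ⊄ stab(m)` because the joint kernel of `{c_d c_d' : d, d' ∈ I}` on the even sector consists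
of PURE spinors (`Λ⁰F`, resp. `Λ¹F`, in the Fock model over `I`) while `|M⟩` is not Gaussian. -/
def MutuallyAnnihilatingBound : Prop :=
  ∀ X : Fin 6 → Matrix (Fin 4 × Bool) (Fin 4 × Bool) ℂ,
    (∀ i, (X i)ᵀ = -(X i)) → (∀ i j, X i * X j = 0) → (∀ i, quadOp 4 (X i) *ᵥ magicM = 0) →
      ¬ LinearIndependent ℂ X

/-- THE LEVER as an identity (PROVED below as `pairProductAnnihilates_holds`; three lines: `c_d c_w ψ₃ = 0` directly, and
`c_d c_w ψ = -c_w c_d ψ + 2 (d ⬝ᵥ w) ψ` on `ψ₁, ψ₂`): if `d` annihilates `ψ₁` and `ψ₂`, `w`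
annihilates `ψ₃` and `d ⊥ w`, then the quadratic operator `c(d) c(w)` kills every combination. -/
def PairProductAnnihilates : Prop :=
  ∀ (ψ : Fin 3 → QReg 8 → ℂ) (d w : Fin 8 × Bool → ℂ) (a : Fin 3 → ℂ),
    majv 8 d *ᵥ ψ 0 = 0 → majv 8 d *ᵥ ψ 1 = 0 → majv 8 w *ᵥ ψ 2 = 0 → d ⬝ᵥ w = 0 →
      (majv 8 d * majv 8 w) *ᵥ (∑ i, a i • ψ i) = 0

/-- `c(d) c(w)` expanded as a double sum. -/
theorem majv_mul_majv (n : ℕ) (d w : Fin n × Bool → ℂ) :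
    majv n d * majv n w =
      ∑ p : Fin n × Bool, ∑ q : Fin n × Bool, (d p * w q) • (majorana n p.1 p.2 * majorana n q.1 q.2) := by
  unfold majv
  rw [Finset.sum_mul]
  refine Finset.sum_congr rfl fun p _ => ?_
  rw [Finset.mul_sum]
  refine Finset.sum_congr rfl fun q _ => ?_
  rw [Matrix.smul_mul, Matrix.mul_smul, smul_smul]

/-- BILINEAR CAR (proved): `c(d) c(w) + c(w) c(d) = 2 β(d,w) · 1` with `β(d,w) = d ⬝ᵥ w`. -/
theorem majv_anticomm (n : ℕ) (d w : Fin n × Bool → ℂ) :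
    majv n d * majv n w + majv n w * majv n d =
      ((2 : ℂ) * (d ⬝ᵥ w)) • (1 : Matrix (QReg n) (QReg n) ℂ) := by
  rw [majv_mul_majv, majv_mul_majv,
    Finset.sum_comm (f := fun q p => (w q * d p) • (majorana n q.1 q.2 * majorana n p.1 p.2)),
    ← Finset.sum_add_distrib]
  have key : ∀ p q : Fin n × Bool,
      (d p * w q) • (majorana n p.1 p.2 * majorana n q.1 q.2) +
        (w q * d p) • (majorana n q.1 q.2 * majorana n p.1 p.2) =
      if p = q then (d p * w q) • ((2 : ℂ) • (1 : Matrix (QReg n) (QReg n) ℂ)) else 0 := by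
    intro p q
    rw [mul_comm (w q) (d p), ← smul_add, majorana_anticommutator]
    split_ifs <;> simp
  simp_rw [← Finset.sum_add_distrib, key, Finset.sum_ite_eq, Finset.mem_univ, if_true]
  rw [← Finset.sum_smul, smul_smul, dotProduct, mul_comm]

/-- THE LEVER IS A THEOREM: `PairProductAnnihilates` holds (three lines, as advertised). -/
theorem pairProductAnnihilates_holds : PairProductAnnihilates := by
  intro ψ d w a hd0 hd1 hw2 hdw
  have hanti : majv 8 d * majv 8 w = -(majv 8 w * majv 8 d) := by
    have h := majv_anticomm 8 d w
    rw [hdw, mul_zero, zero_smul] at h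
    exact eq_neg_of_add_eq_zero_left h
  have h0 : (majv 8 d * majv 8 w) *ᵥ ψ 0 = 0 := by
    rw [hanti, Matrix.neg_mulVec, ← Matrix.mulVec_mulVec, hd0, Matrix.mulVec_zero, neg_zero]
  have h1 : (majv 8 d * majv 8 w) *ᵥ ψ 1 = 0 := by
    rw [hanti, Matrix.neg_mulVec, ← Matrix.mulVec_mulVec, hd1, Matrix.mulVec_zero, neg_zero]
  have h2 : (majv 8 d * majv 8 w) *ᵥ ψ 2 = 0 := by
    rw [← Matrix.mulVec_mulVec, hw2, Matrix.mulVec_zero]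
  rw [Fin.sum_univ_three, Matrix.mulVec_add, Matrix.mulVec_add, Matrix.mulVec_smul,
    Matrix.mulVec_smul, Matrix.mulVec_smul, h0, h1, h2]
  simp

/-- CASE D (hand-proved from `StabiliserBlockDiagonal` + `MutuallyAnnihilatingBound`,
Ideator3Notes §6.4): no 3-term Gaussian decomposition of `M⊗M` in which two of the terms share a
nonzero annihilator. (With `D = L_i ∩ L_j` of dimension `d ∈ {2,4,6}` and the third Lagrangian
`L_k`, the family `D ∧ (L_k ∩ D^⊥)` gives `d(8-d) ≥ 12 > 5 + 5` independent pairwise-annihilating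
stabilising bivectors; `d = 8`, coefficient-zero and common-annihilator sub-cases are the ≤ 2-term
case, killed the same way by `D ∧ L_j`, `dim ≥ 13`.) -/
def NonTransversePairFree : Prop :=
  ∀ (a : Fin 3 → ℂ) (g : Fin 3 → QReg (2 * 4) → ℂ), (∀ i, IsGaussian (g i)) →
    (∃ i j : Fin 3, i ≠ j ∧ ∃ v : Fin 8 × Bool → ℂ, v ≠ 0 ∧ majv 8 v *ᵥ g i = 0 ∧ majv 8 v *ᵥ g j = 0) →
      magicMPow 2 ≠ ∑ i, a i • g i

/-- CASE E, convention-free twin of `TransverseTripleFree` (hand-proved, Ideator3Notes §6.5): no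
3-term decomposition with pairwise TRANSVERSE annihilator Lagrangians. (`sp(L₂, σ)~ ⊂ stab`, with
`σ(e,e') = β(e, φ e')` the symplectic form of the graph `L₁ = {e + φ e}`; block-diagonality makes
`V_A` an `sp(8)`-submodule of `V = L₂ ⊕ L₃ ≅ E ⊕ E*`, hence the graph of a module map `E → E*`,
on which the invariant symmetric form `β` is `τ + τᵗ` with `τ ∈ ℂσ` skew — so `β|V_A = 0`,
absurd.) -/
def TransverseTripleFreeAnn : Prop :=
  ∀ (a : Fin 3 → ℂ) (g : Fin 3 → QReg (2 * 4) → ℂ), (∀ i, IsGaussian (g i)) →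
    (∀ i j : Fin 3, i ≠ j → ∀ v : Fin 8 × Bool → ℂ, majv 8 v *ᵥ g i = 0 → majv 8 v *ᵥ g j = 0 → v = 0) →
      magicMPow 2 ≠ ∑ i, a i • g i

/-- KERNEL-CHECKED COMPOSITION of the line: cases D and E exhaust all triples, so together they
ARE the crux `GaussRankTwoCopies` (by name). -/
theorem crux_of_cases (hD : NonTransversePairFree) (hE : TransverseTripleFreeAnn) :
    Summit.QuantumAdvantage.QuantumAdvantage.Theses.SpinorFlattening.GaussRankTwoCopies := by
  intro a g hg
  by_cases h : ∃ i j : Fin 3, i ≠ j ∧ ∃ v : Fin 8 × Bool → ℂ,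
      v ≠ 0 ∧ majv 8 v *ᵥ g i = 0 ∧ majv 8 v *ᵥ g j = 0
  · exact hD a g hg h
  · refine hE a g hg ?_
    intro i j hij v hvi hvj
    by_contra hv
    exact h ⟨i, j, hij, v, hv, hvi, hvj⟩


end

end Summit.QuantumAdvantage.QuantumAdvantage.Cruxes.GaussRankTwoCopies.Ideator3
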